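import Literature.NumberTheory.Transcendental.KZFibredRelations

/-!
# `BetaCancellation` (stmt-KontsevichZagierPeriods-13633), line `dirichlet-companion-to-pi` — stub `stub_wallRestrict`

**Wall restriction.** Let `S` be one of the two open sides `(-∞, -1/2)`, `(-1/2, ∞)` of the wall
`z 0 = -1/2` in the parameter coordinate, and let `H : FormalRep →+ FormalRep` be any additive
endomorphism which kills the generators of dimension `0` and sends the generator `[r]` of a
representation `r` of dimension `k + 1` to `[s]` whenever `s` is the restriction of `r` to
`r.domain ∩ {z | z 0 ∈ S}` (same integrand). Then `H` maps the subgroup generated by the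
*wall-respecting generators* — all domain- and integrand-additivity instances (`KZ.domainAddRel`,
`KZ.integrandAddRel`), the changes of variables `Φ` on `(n+1)`-dimensional representations
preserving both open sides of the wall pointwise
(`(Φ x 0 < -1/2 ↔ x 0 < -1/2) ∧ (-1/2 < Φ x 0 ↔ -1/2 < x 0)` on the domain), and the
Newton–Leibniz moves over a base of dimension `≥ 1` (`KZ.fibredNewtonLeibnizRel`) — into
`KZ.relations`.

Proof. Generator by generator, exactly the pattern of `KZ.slabMap_mem_fibredRelations` with the
slab `{a < z 0 < b}` replaced by the half-space `{z 0 ∈ S}` (`AddSubgroup.closure_le` for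
`relations.comap H`): a restricted additivity instance is an additivity instance
(`wallRestrict_domainAddRel`, `wallRestrict_integrandAddRel`; in dimension `0` the image is `0`);
a wall-respecting change of variables maps `r.domain ∩ {z 0 ∈ S}` onto `r'.domain ∩ {z 0 ∈ S}`
because `Φ x 0 ∈ S ↔ x 0 ∈ S`, all other clauses restrict (`wallRestrict_changeOfVariablesRel`);
a Newton–Leibniz move over a base of dimension `≥ 1` restricts to the Newton–Leibniz move over the
restricted base since the parameter is a base coordinate, `(Fin.init z) 0 = z 0`
(`wallRestrict_newtonLeibnizRel`). The half-spaces are `ℚ`-semialgebraic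
(`wallRestrict_isSemialgebraic_Iio`, `wallRestrict_isSemialgebraic_Ioi`), so the restricted
representations exist (`KZ.IntegralRep.restrict`, `wallRestrict_exists_restrict`) and `H` is
evaluated on them through its two pinning hypotheses only. No definitions; sorry-free;
axioms ⊆ {propext, Classical.choice, Quot.sound}.

References: M. Kontsevich, D. Zagier, *Periods* (2001), §1.2 rules (1)–(3); J. Ayoub, *Une version
relative de la conjecture des périodes de Kontsevich–Zagier*, Ann. of Math. 181 (2015), §1.
-/

noncomputable section

-- `Summit.KontsevichZagierPeriods.KontsevichZagierPeriods.…` is the tree's mandated layout (single-conjunct summit).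
set_option linter.dupNamespace false

namespace Summit.KontsevichZagierPeriods.KontsevichZagierPeriods.BetaCancellationLine

open Set
open Literature.NumberTheory.Transcendental
open Literature.NumberTheory.Transcendental.KZ

/-! ### The two open sides of the wall are `ℚ`-semialgebraic -/

/-- The open side `{z | z 0 < -1/2}` of the wall is `ℚ`-semialgebraic in every dimension `≥ 1`
(one strict polynomial inequality with rational coefficients). [folklore] -/
theorem wallRestrict_isSemialgebraic_Iio (k : ℕ) :
    Literature.ModelTheory.ExponentialFields.IsSemialgebraic ℚ
      {z : Fin (k + 1) → ℝ | z 0 ∈ Set.Iio (-1/2 : ℝ)} := by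
  have h := Literature.ModelTheory.ExponentialFields.isSemialgebraic_setOf_eval_lt
    (k := ℚ) (R := ℝ) (MvPolynomial.X (0 : Fin (k + 1))) (MvPolynomial.C (-1/2 : ℚ))
  have e : {z : Fin (k + 1) → ℝ | z 0 ∈ Set.Iio (-1/2 : ℝ)} =
      {x : Fin (k + 1) → ℝ |
        MvPolynomial.aeval x (MvPolynomial.X (0 : Fin (k + 1)) : MvPolynomial (Fin (k + 1)) ℚ) <
        MvPolynomial.aeval x (MvPolynomial.C (-1/2 : ℚ) : MvPolynomial (Fin (k + 1)) ℚ)} := by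
    ext z
    simp only [mem_setOf_eq, mem_Iio, MvPolynomial.aeval_X, MvPolynomial.aeval_C, eq_ratCast]
    push_cast
    exact Iff.rfl
  rw [e]
  exact h

/-- The open side `{z | -1/2 < z 0}` of the wall is `ℚ`-semialgebraic in every dimension `≥ 1`
(one strict polynomial inequality with rational coefficients). [folklore] -/
theorem wallRestrict_isSemialgebraic_Ioi (k : ℕ) :
    Literature.ModelTheory.ExponentialFields.IsSemialgebraic ℚ
      {z : Fin (k + 1) → ℝ | z 0 ∈ Set.Ioi (-1/2 : ℝ)} := by
  have h := Literature.ModelTheory.ExponentialFields.isSemialgebraic_setOf_eval_lt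
    (k := ℚ) (R := ℝ) (MvPolynomial.C (-1/2 : ℚ)) (MvPolynomial.X (0 : Fin (k + 1)))
  have e : {z : Fin (k + 1) → ℝ | z 0 ∈ Set.Ioi (-1/2 : ℝ)} =
      {x : Fin (k + 1) → ℝ |
        MvPolynomial.aeval x (MvPolynomial.C (-1/2 : ℚ) : MvPolynomial (Fin (k + 1)) ℚ) <
        MvPolynomial.aeval x (MvPolynomial.X (0 : Fin (k + 1)) : MvPolynomial (Fin (k + 1)) ℚ)} := by
    ext z
    simp only [mem_setOf_eq, mem_Ioi, MvPolynomial.aeval_X, MvPolynomial.aeval_C, eq_ratCast]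
    push_cast
    exact Iff.rfl
  rw [e]
  exact h

/-- **Side restrictions of a family exist**: for a `ℚ`-semialgebraic half-space `{z 0 ∈ S}` every
representation `r` of dimension `≥ 1` has a restriction to `r.domain ∩ {z 0 ∈ S}` with the same
integrand (`KZ.IntegralRep.restrict`). [folklore] -/
theorem wallRestrict_exists_restrict {k : ℕ} {S : Set ℝ}
    (hSA : Literature.ModelTheory.ExponentialFields.IsSemialgebraic ℚ
      {z : Fin (k + 1) → ℝ | z 0 ∈ S})
    (r : IntegralRep (k + 1)) :
    ∃ s : IntegralRep (k + 1), s.domain = r.domain ∩ {z | z 0 ∈ S} ∧ s.integrand = r.integrand :=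
  ⟨r.restrict (r.domain ∩ {z | z 0 ∈ S}) (r.isSemialgebraic_domain.inter hSA) inter_subset_left,
    rfl, rfl⟩

/-! ### Restriction to a subdomain preserves the wall-respecting generators -/

/-- Restricting a domain-additivity instance `[r] − [r₁] − [r₂]` to a common set `T` (each domain
cut down to `· ∩ T`, integrands unchanged) gives a domain-additivity instance.
[cite: KontsevichZagier2001, §1.2 rule (1)] -/
theorem wallRestrict_domainAddRel {k : ℕ} {T : Set (Fin k → ℝ)} {r r₁ r₂ s s₁ s₂ : IntegralRep k}
    (hdom : r.domain = r₁.domain ∪ r₂.domain)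
    (hnull : MeasureTheory.volume (r₁.domain ∩ r₂.domain) = 0)
    (h₁ : EqOn r.integrand r₁.integrand r₁.domain) (h₂ : EqOn r.integrand r₂.integrand r₂.domain)
    (hs : s.domain = r.domain ∩ T) (hsi : s.integrand = r.integrand)
    (hs₁ : s₁.domain = r₁.domain ∩ T) (hs₁i : s₁.integrand = r₁.integrand)
    (hs₂ : s₂.domain = r₂.domain ∩ T) (hs₂i : s₂.integrand = r₂.integrand) :
    of s - of s₁ - of s₂ ∈ domainAddRel := by
  refine ⟨k, s, s₁, s₂, ?_, ?_, ?_, ?_, rfl⟩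
  · rw [hs, hs₁, hs₂, hdom, union_inter_distrib_right]
  · rw [hs₁, hs₂]
    exact MeasureTheory.measure_mono_null (fun z hz => mem_inter hz.1.1 hz.2.1) hnull
  · rw [hsi, hs₁i, hs₁]
    exact fun z hz => h₁ hz.1
  · rw [hsi, hs₂i, hs₂]
    exact fun z hz => h₂ hz.1

/-- Restricting an integrand-additivity instance `[r] − [r₁] − [r₂]` to a set `T` gives an
integrand-additivity instance. [cite: KontsevichZagier2001, §1.2 rule (1)] -/
theorem wallRestrict_integrandAddRel {k : ℕ} {T : Set (Fin k → ℝ)} {r r₁ r₂ s s₁ s₂ : IntegralRep k}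
    (h₁ : r₁.domain = r.domain) (h₂ : r₂.domain = r.domain)
    (hadd : EqOn r.integrand (r₁.integrand + r₂.integrand) r.domain)
    (hs : s.domain = r.domain ∩ T) (hsi : s.integrand = r.integrand)
    (hs₁ : s₁.domain = r₁.domain ∩ T) (hs₁i : s₁.integrand = r₁.integrand)
    (hs₂ : s₂.domain = r₂.domain ∩ T) (hs₂i : s₂.integrand = r₂.integrand) :
    of s - of s₁ - of s₂ ∈ integrandAddRel := by
  refine ⟨k, s, s₁, s₂, ?_, ?_, ?_, rfl⟩
  · rw [hs₁, hs, h₁]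
  · rw [hs₂, hs, h₂]
  · rw [hsi, hs₁i, hs₂i, hs]
    exact fun z hz => hadd hz.1

/-- **Restriction of a wall-respecting change of variables to a side of the wall is a change of
variables**: since `Φ x 0 ∈ S ↔ x 0 ∈ S` on `r.domain`, `Φ` maps `r.domain ∩ {z 0 ∈ S}` onto
`r'.domain ∩ {z 0 ∈ S}`; semialgebraicity, differentiability within the domain, injectivity and the
Jacobian identity restrict. [cite: KontsevichZagier2001, §1.2 rule (2)] -/
theorem wallRestrict_changeOfVariablesRel {k : ℕ} (S : Set ℝ) {r r' s s' : IntegralRep (k + 1)}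
    {Φ : (Fin (k + 1) → ℝ) → (Fin (k + 1) → ℝ)}
    {Φ' : (Fin (k + 1) → ℝ) → (Fin (k + 1) → ℝ) →L[ℝ] (Fin (k + 1) → ℝ)}
    (hΦ : IsSemialgebraicMapOn ℚ r.domain Φ)
    (hΦ' : ∀ x ∈ r.domain, HasFDerivWithinAt Φ (Φ' x) r.domain x) (hinj : InjOn Φ r.domain)
    (hdom : r'.domain = Φ '' r.domain)
    (hf : ∀ x ∈ r.domain, r.integrand x = r'.integrand (Φ x) * |(Φ' x).det|)
    (hwall : ∀ x ∈ r.domain, Φ x 0 ∈ S ↔ x 0 ∈ S)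
    (hs : s.domain = r.domain ∩ {z | z 0 ∈ S}) (hsi : s.integrand = r.integrand)
    (hs' : s'.domain = r'.domain ∩ {z | z 0 ∈ S}) (hs'i : s'.integrand = r'.integrand) :
    of s - of s' ∈ changeOfVariablesRel := by
  have hsub : s.domain ⊆ r.domain := hs.trans_subset inter_subset_left
  refine ⟨k + 1, s, s', Φ, Φ', hΦ.mono hsub s.isSemialgebraic_domain,
    fun x hx => (hΦ' x (hsub hx)).mono hsub, hinj.mono hsub, ?_, fun x hx => ?_, rfl⟩
  · rw [hs', hs, hdom]
    ext y
    simp only [mem_inter_iff, mem_image, mem_setOf_eq]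
    constructor
    · rintro ⟨⟨x, hx, rfl⟩, hy⟩
      exact ⟨x, ⟨hx, (hwall x hx).mp hy⟩, rfl⟩
    · rintro ⟨x, ⟨hx, hxS⟩, rfl⟩
      exact ⟨⟨x, hx, rfl⟩, (hwall x hx).mpr hxS⟩
  · rw [hsi, hs'i]
    exact hf x (hsub hx)

/-- **Restriction of a Newton–Leibniz move over a base of dimension `≥ 1` to a side of the wall is
again such a move**: the parameter `z 0` is a base coordinate (`(Fin.init z) 0 = z 0`), so the
restricted band is the band over the restricted base, with the same bounds and primitive.
[cite: KontsevichZagier2001, §1.2 rule (3)] -/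
theorem wallRestrict_newtonLeibnizRel {n : ℕ} (S : Set ℝ) {r s : IntegralRep (n + 2)}
    {r' s' : IntegralRep (n + 1)} {α β : (Fin (n + 1) → ℝ) → ℝ} {F : (Fin (n + 2) → ℝ) → ℝ}
    (hF : IsSemialgebraicFunOn ℚ r.domain F)
    (hα : IsSemialgebraicFunOn ℚ r'.domain α) (hβ : IsSemialgebraicFunOn ℚ r'.domain β)
    (hle : ∀ x ∈ r'.domain, α x ≤ β x)
    (hband : r.domain = {z | (Fin.init z : Fin (n + 1) → ℝ) ∈ r'.domain ∧
      α (Fin.init z) ≤ z (Fin.last (n + 1)) ∧ z (Fin.last (n + 1)) ≤ β (Fin.init z)})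
    (hcont : ∀ x ∈ r'.domain, ContinuousOn (fun t : ℝ => F (Fin.snoc x t)) (Icc (α x) (β x)))
    (hderiv : ∀ x ∈ r'.domain, ∀ t ∈ Ioo (α x) (β x),
      HasDerivAt (fun s : ℝ => F (Fin.snoc x s)) (r.integrand (Fin.snoc x t)) t)
    (hr' : ∀ x ∈ r'.domain, r'.integrand x = F (Fin.snoc x (β x)) - F (Fin.snoc x (α x)))
    (hs : s.domain = r.domain ∩ {z | z 0 ∈ S}) (hsi : s.integrand = r.integrand)
    (hs' : s'.domain = r'.domain ∩ {z | z 0 ∈ S}) (hs'i : s'.integrand = r'.integrand) :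
    of s - of s' ∈ newtonLeibnizRel := by
  have hsub : s.domain ⊆ r.domain := hs.trans_subset inter_subset_left
  have hsub' : s'.domain ⊆ r'.domain := hs'.trans_subset inter_subset_left
  refine ⟨n + 1, s, s', α, β, F, hF.mono hsub s.isSemialgebraic_domain,
    hα.mono hsub' s'.isSemialgebraic_domain, hβ.mono hsub' s'.isSemialgebraic_domain,
    fun x hx => hle x (hsub' hx), ?_, fun x hx => hcont x (hsub' hx), fun x hx t ht => ?_,
    fun x hx => ?_, rfl⟩
  · rw [hs, hs', hband]
    ext z
    simp only [mem_inter_iff, mem_setOf_eq]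
    have h0 : Fin.init z 0 = z 0 := rfl
    rw [h0]
    tauto
  · rw [hsi]
    exact hderiv x (hsub' hx) t ht
  · rw [hs'i]
    exact hr' x (hsub' hx)

/-! ### Wall restriction maps wall-respecting relations to relations -/

/-- **Wall restriction, for a general side set**: if every half-space `{z 0 ∈ S}` is
`ℚ`-semialgebraic and membership in `S` is decided by the position relative to `-1/2`, then any
additive `H` killing constants and restricting families to `{z 0 ∈ S}` maps the closure of the
wall-respecting generators into `relations` (generatorwise, `AddSubgroup.closure_le`). [folklore] -/
theorem wallRestrict_of_side (S : Set ℝ)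
    (hSA : ∀ k : ℕ, Literature.ModelTheory.ExponentialFields.IsSemialgebraic ℚ
      {z : Fin (k + 1) → ℝ | z 0 ∈ S})
    (hSw : ∀ t u : ℝ, (t < -1/2 ↔ u < -1/2) ∧ (-1/2 < t ↔ -1/2 < u) → (t ∈ S ↔ u ∈ S))
    (H : FormalRep →+ FormalRep) (h0 : ∀ r : IntegralRep 0, H (of r) = 0)
    (hpin : ∀ (k : ℕ) (r s : IntegralRep (k + 1)), s.domain = r.domain ∩ {z | z 0 ∈ S} →
      s.integrand = r.integrand → H (of r) = of s)
    {x : FormalRep}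
    (hx : x ∈ AddSubgroup.closure (domainAddRel ∪ integrandAddRel ∪
          {x | ∃ (n : ℕ) (r r' : IntegralRep (n + 1)) (Φ : (Fin (n + 1) → ℝ) → (Fin (n + 1) → ℝ))
              (Φ' : (Fin (n + 1) → ℝ) → (Fin (n + 1) → ℝ) →L[ℝ] (Fin (n + 1) → ℝ)),
            IsSemialgebraicMapOn ℚ r.domain Φ ∧
            (∀ x ∈ r.domain, HasFDerivWithinAt Φ (Φ' x) r.domain x) ∧ Set.InjOn Φ r.domain ∧
            r'.domain = Φ '' r.domain ∧
            (∀ x ∈ r.domain, r.integrand x = r'.integrand (Φ x) * |(Φ' x).det|) ∧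
            (∀ x ∈ r.domain, (Φ x 0 < -1/2 ↔ x 0 < -1/2) ∧ (-1/2 < Φ x 0 ↔ -1/2 < x 0)) ∧
            x = of r - of r'} ∪
          fibredNewtonLeibnizRel)) :
    H x ∈ relations := by
  refine (AddSubgroup.closure_le (relations.comap H)).mpr ?_ hx
  rintro y (((hy | hy) | hy) | hy)
  · obtain ⟨k, r, r₁, r₂, hdom, hnull, h₁, h₂, rfl⟩ := hy
    rw [AddSubgroup.coe_comap, mem_preimage, map_sub, map_sub]
    cases k with
    | zero =>
      rw [h0 r, h0 r₁, h0 r₂, sub_zero, sub_zero]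
      exact relations.zero_mem
    | succ k =>
      obtain ⟨s, hs, hsi⟩ := wallRestrict_exists_restrict (hSA k) r
      obtain ⟨s₁, hs₁, hs₁i⟩ := wallRestrict_exists_restrict (hSA k) r₁
      obtain ⟨s₂, hs₂, hs₂i⟩ := wallRestrict_exists_restrict (hSA k) r₂
      rw [hpin k r s hs hsi, hpin k r₁ s₁ hs₁ hs₁i, hpin k r₂ s₂ hs₂ hs₂i]
      exact domainAddRel_subset_relations
        (wallRestrict_domainAddRel hdom hnull h₁ h₂ hs hsi hs₁ hs₁i hs₂ hs₂i)
  · obtain ⟨k, r, r₁, r₂, h₁, h₂, hadd, rfl⟩ := hy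
    rw [AddSubgroup.coe_comap, mem_preimage, map_sub, map_sub]
    cases k with
    | zero =>
      rw [h0 r, h0 r₁, h0 r₂, sub_zero, sub_zero]
      exact relations.zero_mem
    | succ k =>
      obtain ⟨s, hs, hsi⟩ := wallRestrict_exists_restrict (hSA k) r
      obtain ⟨s₁, hs₁, hs₁i⟩ := wallRestrict_exists_restrict (hSA k) r₁
      obtain ⟨s₂, hs₂, hs₂i⟩ := wallRestrict_exists_restrict (hSA k) r₂
      rw [hpin k r s hs hsi, hpin k r₁ s₁ hs₁ hs₁i, hpin k r₂ s₂ hs₂ hs₂i]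
      exact integrandAddRel_subset_relations
        (wallRestrict_integrandAddRel h₁ h₂ hadd hs hsi hs₁ hs₁i hs₂ hs₂i)
  · obtain ⟨k, r, r', Φ, Φ', hΦ, hΦ', hinj, hdom, hf, hwall, rfl⟩ := hy
    rw [AddSubgroup.coe_comap, mem_preimage, map_sub]
    obtain ⟨s, hs, hsi⟩ := wallRestrict_exists_restrict (hSA k) r
    obtain ⟨s', hs', hs'i⟩ := wallRestrict_exists_restrict (hSA k) r'
    rw [hpin k r s hs hsi, hpin k r' s' hs' hs'i]
    exact changeOfVariablesRel_subset_relations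
      (wallRestrict_changeOfVariablesRel S hΦ hΦ' hinj hdom hf
        (fun z hz => hSw (Φ z 0) (z 0) (hwall z hz)) hs hsi hs' hs'i)
  · obtain ⟨k, r, r', α, β, F, hF, hα, hβ, hle, hband, hcont, hderiv, hr', rfl⟩ :=
      mem_fibredNewtonLeibnizRel_iff.mp hy
    rw [AddSubgroup.coe_comap, mem_preimage, map_sub]
    obtain ⟨s, hs, hsi⟩ := wallRestrict_exists_restrict (hSA (k + 1)) r
    obtain ⟨s', hs', hs'i⟩ := wallRestrict_exists_restrict (hSA k) r'
    rw [hpin (k + 1) r s hs hsi, hpin k r' s' hs' hs'i]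
    exact newtonLeibnizRel_subset_relations
      (wallRestrict_newtonLeibnizRel S hF hα hβ hle hband hcont hderiv hr' hs hsi hs' hs'i)

/-- STUB (wall restriction): restriction to an open side of the wall `x = -1/2` maps wall-respecting
relations to relations. [folklore] -/
theorem stub_wallRestrict :
    ∀ (S : Set ℝ), (S = Set.Iio (-1/2 : ℝ) ∨ S = Set.Ioi (-1/2 : ℝ)) →
    ∀ (H : FormalRep →+ FormalRep),
      (∀ r : IntegralRep 0, H (of r) = 0) →
      (∀ (k : ℕ) (r s : IntegralRep (k + 1)), s.domain = r.domain ∩ {z | z 0 ∈ S} →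
          s.integrand = r.integrand → H (of r) = of s) →
      ∀ x ∈ AddSubgroup.closure (domainAddRel ∪ integrandAddRel ∪
          {x | ∃ (n : ℕ) (r r' : IntegralRep (n + 1)) (Φ : (Fin (n + 1) → ℝ) → (Fin (n + 1) → ℝ))
              (Φ' : (Fin (n + 1) → ℝ) → (Fin (n + 1) → ℝ) →L[ℝ] (Fin (n + 1) → ℝ)),
            IsSemialgebraicMapOn ℚ r.domain Φ ∧
            (∀ x ∈ r.domain, HasFDerivWithinAt Φ (Φ' x) r.domain x) ∧ Set.InjOn Φ r.domain ∧
            r'.domain = Φ '' r.domain ∧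
            (∀ x ∈ r.domain, r.integrand x = r'.integrand (Φ x) * |(Φ' x).det|) ∧
            (∀ x ∈ r.domain, (Φ x 0 < -1/2 ↔ x 0 < -1/2) ∧ (-1/2 < Φ x 0 ↔ -1/2 < x 0)) ∧
            x = of r - of r'} ∪
          fibredNewtonLeibnizRel),
        H x ∈ relations := by
  intro S hS H h0 hpin x hx
  rcases hS with rfl | rfl
  · exact wallRestrict_of_side (Set.Iio (-1/2 : ℝ)) wallRestrict_isSemialgebraic_Iio
      (fun t u h => h.1) H h0 hpin hx
  · exact wallRestrict_of_side (Set.Ioi (-1/2 : ℝ)) wallRestrict_isSemialgebraic_Ioi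
      (fun t u h => h.2) H h0 hpin hx

end Summit.KontsevichZagierPeriods.KontsevichZagierPeriods.BetaCancellationLine
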